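/-
Copyright (c) 2026. All rights reserved.
Released under Apache 2.0 license as described in the file LICENSE.
-/
import Literature.NumberTheory.Automorphic.MahlerCriterionPrelims
import Literature.NumberTheory.Automorphic.AdelicVectorHeightGalois
import Literature.NumberTheory.Automorphic.AdelicVectorHeightPairing
import Literature.NumberTheory.Automorphic.AdelicVectorHeightBound
import Literature.NumberTheory.Automorphic.AdelicUnitaryGroup
import HarnessLib

/-!
# Heights on an anisotropic adelic unitary group (Godement's criterion, part 1)

For a CM field `L`, `H ∈ M_n(L)` and the CM conjugation `c` with **anisotropic** hermitian form
`⟪x, y⟫ = (c x)ᵀ H y` (`⟪x, x⟫ = 0 ⇒ x = 0` on `Lⁿ`):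

* § 2 `hermForm_mulVec_mulVec`, `algebraMap_hermForm` — invariance of `⟪·,·⟫_H` under the unitary
  group and base change to `𝔸_L` (hermitian forms of the tree's `UnitaryBallQuotientDatum`);
* § 3 `vecHeight_adeleConj`, `ideleNorm_unitsMap_adeleConj` — Galois invariance of heights and
  idele norms under `c ⊗ id` (from `AdelicVectorHeightGalois`);
* § 4 `exists_vecHeight_floor` — **the height floor**: `h(g ξ) ≥ c > 0` uniformly for
  `g ∈ U(H)(𝔸_L)`, `ξ ∈ Lⁿ ∖ 0` (anisotropy + product formula + the fundamental inequality
  `|xᵀ y|_𝔸 ≤ h(x) h(y)` of `AdelicVectorHeightPairing`), and `ideleNorm_det_eq_one` —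
  `|det g|_𝔸 = 1` on `U(H)(𝔸_L)`.

References: R. Godement, *Domaines fondamentaux des groupes arithmétiques*, Sém. Bourbaki 257
(1962/63), §§ 1–4; A. Borel, *Introduction aux groupes arithmétiques* (1969), § 8; V. Platonov and
A. Rapinchuk, *Algebraic groups and number theory* (1994), § 5.3.

## Provenance

LEAN-IN-TREE migration (class L) of §§ 2–4 of the Hodge-CM cell package module
`HodgeCM/PerL34/GodementCompact.lean` (expansion seat pv10-g4, 2026-08-18), verbatim modulo the
namespace (`HodgeCM.PerL34.Godement` ↦ `Literature.NumberTheory.Automorphic.Godement`) and the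
re-basing on the tree's `AdelicUnitaryGroup` (`conjRingHomK ↦ cmConjRingHom`),
`AdelicVectorHeightGalois`, `MahlerCriterionPrelims` (`glTranspose ↦ transposeGL`);
`ideleNorm_unitsMap_adeleConj` is re-proved through `vecHeight_single` (the package went through its
own real-valued idele norm).
-/

set_option autoImplicit false

noncomputable section

open scoped NNReal Matrix Pointwise MatrixGroups
open NumberField IsDedekindDomain

namespace Literature.NumberTheory.Automorphic.Godement

open Literature.AlgebraicGeometry.ShimuraVarieties

/-! ## §2 Hermitian forms: invariance under the unitary group, base change to the adeles -/

section Hermitian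

variable {R : Type*} [CommRing R] {m : Type*} [Fintype m] [DecidableEq m]

/-- `⟪g u, g v⟫ = ⟪u, v⟫` for `g` in the unitary group of `⟪·, ·⟫_H`. [folklore] -/
theorem hermForm_mulVec_mulVec {σ : R →+* R} {H : Matrix m m R} {g : GL m R}
    (hg : g ∈ unitaryGroup σ H) (u v : m → R) :
    hermForm σ H ((g : Matrix m m R) *ᵥ u) ((g : Matrix m m R) *ᵥ v) = hermForm σ H u v := by
  rw [mem_unitaryGroup_iff] at hg
  unfold hermForm
  have h1 : (σ ∘ ((g : Matrix m m R) *ᵥ u)) = ((g : Matrix m m R).map σ) *ᵥ (σ ∘ u) := by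
    funext i
    exact RingHom.map_mulVec σ _ u i
  rw [h1]
  calc ((g : Matrix m m R).map σ *ᵥ (σ ∘ u)) ⬝ᵥ (H *ᵥ ((g : Matrix m m R) *ᵥ v))
      = ((σ ∘ u) ᵥ* ((g : Matrix m m R).map σ)ᵀ) ⬝ᵥ (H *ᵥ ((g : Matrix m m R) *ᵥ v)) := by
        rw [Matrix.vecMul_transpose]
    _ = (σ ∘ u) ⬝ᵥ ((((g : Matrix m m R).map σ)ᵀ * H * (g : Matrix m m R)) *ᵥ v) := by
        rw [← Matrix.dotProduct_mulVec]
        simp only [Matrix.mulVec_mulVec, Matrix.mul_assoc]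
    _ = (σ ∘ u) ⬝ᵥ (H *ᵥ v) := by rw [hg]

end Hermitian

section CMField

variable (L : Type) [Field L] [NumberField L] [IsCMField L]
variable {n : Type} [Fintype n] [DecidableEq n]

local notation "𝔸L" => AdeleRing (𝓞 L) L

omit [DecidableEq n] in
/-- Base change of the hermitian form to the adeles on principal vectors:
`(⟪ξ, η⟫_H)_𝔸 = ⟪ξ_𝔸, η_𝔸⟫_{H_𝔸}` for the involution `c ⊗ id` of `𝔸_L`. [folklore] -/
theorem algebraMap_hermForm (H : Matrix n n L) (ξ η : n → L) :
    algebraMap L 𝔸L (hermForm (cmConjRingHom L) H ξ η) =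
      hermForm (adeleConj L) (H.map (algebraMap L 𝔸L)) (principalVec L ξ) (principalVec L η) := by
  unfold hermForm
  rw [RingHom.map_dotProduct]
  have h1 : (algebraMap L 𝔸L) ∘ (cmConjRingHom L ∘ ξ) = adeleConj L ∘ principalVec L ξ := by
    funext i
    simp only [Function.comp_apply, principalVec, adeleConj_algebraMap]
  have h2 : (algebraMap L 𝔸L) ∘ (H *ᵥ η) = H.map (algebraMap L 𝔸L) *ᵥ principalVec L η := by
    funext i
    rw [Function.comp_apply, RingHom.map_mulVec]
    rfl
  rw [h1, h2]

/-! ## §3 Galois invariance: heights and idele norms under `c ⊗ id` -/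

omit [Fintype n] [DecidableEq n] in
/-- Coordinatewise conjugation is the Galois action of `c` on adelic vectors (definitional).
[folklore] -/
theorem adeleConj_comp_eq_smul (x : n → 𝔸L) :
    (adeleConj L ∘ x) = (IsCMField.complexConj L) • x := rfl

omit [DecidableEq n] in
/-- `h(c x) = h(x)` for adelic vectors. [folklore] -/
theorem vecHeight_adeleConj (x : n → 𝔸L) : vecHeight L (adeleConj L ∘ x) = vecHeight L x := by
  rw [adeleConj_comp_eq_smul]
  exact vecHeight_galSmul (IsCMField.complexConj L) x

omit [DecidableEq n] in
/-- Finite height data is preserved by `c ⊗ id`. [folklore] -/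
theorem isHeightFinite_adeleConj {x : n → 𝔸L} (hx : IsHeightFinite L x) :
    IsHeightFinite L (adeleConj L ∘ x) := by
  rw [adeleConj_comp_eq_smul]
  exact (isHeightFinite_galSmul_iff (IsCMField.complexConj L) x).mpr hx

/-- `|c a|_𝔸 = |a|_𝔸` for ideles `a` (via `h(c x) = h(x)` on the vector `a · e₀`). [folklore] -/
theorem ideleNorm_unitsMap_adeleConj (d : (𝔸L)ˣ) :
    IdeleClassGroup.ideleNorm L (Units.map (adeleConj L : 𝔸L →* 𝔸L) d) =
      IdeleClassGroup.ideleNorm L d := by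
  classical
  have h1 : (Pi.single (0 : Fin 1) ((Units.map (adeleConj L : 𝔸L →* 𝔸L) d : (𝔸L)ˣ) : 𝔸L) :
      Fin 1 → 𝔸L) = adeleConj L ∘ Pi.single (0 : Fin 1) (d : 𝔸L) := by
    funext j
    by_cases hj : j = 0
    · subst hj
      simp only [Function.comp_apply, Pi.single_eq_same, Units.coe_map, MonoidHom.coe_coe]
    · simp only [Function.comp_apply, Pi.single_eq_of_ne hj, map_zero]
  rw [← vecHeight_single (K := L) (0 : Fin 1), h1, vecHeight_adeleConj, vecHeight_single]

/-! ## §4 The height floor and `|det| = 1` on an anisotropic adelic unitary group -/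

omit [DecidableEq n] in
/-- An anisotropic form has `det H ≠ 0`. [folklore] -/
theorem det_ne_zero_of_anisotropic [DecidableEq n] (H : Matrix n n L)
    (hanis : ∀ x : n → L, hermForm (cmConjRingHom L) H x x = 0 → x = 0) : H.det ≠ 0 := by
  intro hdet
  obtain ⟨v, hv, hHv⟩ := Matrix.exists_mulVec_eq_zero_iff.mpr hdet
  refine hv (hanis v ?_)
  unfold hermForm
  rw [hHv, dotProduct_zero]

omit [IsCMField L] in
/-- For `g ∈ U(H)(𝔸)` and `ξ ∈ Lⁿ`, the vector `H_𝔸 (g ξ_𝔸)` is `ξ_𝔸 (H_𝔸 g)ᵀ`, a primitive vector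
under an element of `GL_n(𝔸_L)` when `det H ≠ 0`. [folklore] -/
theorem mulVec_mulVec_principalVec_eq (H : Matrix n n L) (hdet : H.det ≠ 0)
    (g : GL n 𝔸L) (ξ : n → L) :
    H.map (algebraMap L 𝔸L) *ᵥ ((g : Matrix n n 𝔸L) *ᵥ principalVec L ξ) =
      principalVec L ξ ᵥ*
        ((Mahler.transposeGL (toAdeleGL L (Matrix.GeneralLinearGroup.mkOfDetNeZero H hdet) * g) :
          GL n 𝔸L) : Matrix n n 𝔸L) := by
  rw [Mahler.vecMul_transposeGL, Units.val_mul, ← Matrix.mulVec_mulVec]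
  rfl

/-- **The height floor on `U(H)(𝔸)`**: if `⟪·, ·⟫_H` is anisotropic, there is `c > 0` with
`c ≤ h(g ξ_𝔸)` for all `g ∈ U(H)(𝔸_{L⁺})` and all `ξ ∈ Lⁿ ∖ 0`
(Godement, Sém. Bourbaki 257, §4, Lemme 4; Platonov–Rapinchuk, proof of Thm. 5.5). [folklore] -/
theorem exists_vecHeight_floor (H : Matrix n n L)
    (hanis : ∀ x : n → L, hermForm (cmConjRingHom L) H x x = 0 → x = 0) :
    ∃ c : ℝ≥0, 0 < c ∧ ∀ g ∈ adelicUnitaryGroup L H, ∀ ξ : n → L, ξ ≠ 0 →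
      c ≤ vecHeight L ((g : Matrix n n 𝔸L) *ᵥ principalVec L ξ) := by
  have hdet : H.det ≠ 0 := det_ne_zero_of_anisotropic L H hanis
  set HA : Matrix n n 𝔸L := H.map (algebraMap L 𝔸L) with hHA
  set B : ℝ≥0 := matHeightBound L HAᵀ with hB
  have hM : (1 ⊔ B) ≠ 0 := ne_of_gt (lt_of_lt_of_le zero_lt_one le_sup_left)
  refine ⟨(1 ⊔ B)⁻¹, inv_pos.mpr (pos_of_ne_zero hM), fun g hg ξ hξ => ?_⟩
  -- notation
  set y : n → 𝔸L := (g : Matrix n n 𝔸L) *ᵥ principalVec L ξ with hy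
  -- `q = ⟪ξ, ξ⟫ ∈ L×`, `|q|_𝔸 = 1`
  set q : L := hermForm (cmConjRingHom L) H ξ ξ with hq
  have hq0 : q ≠ 0 := fun h => hξ (hanis ξ h)
  set a : (𝔸L)ˣ := Units.map (algebraMap L 𝔸L : L →* 𝔸L) (Units.mk0 q hq0) with ha
  have ha1 : IdeleClassGroup.ideleNorm L a = 1 := ideleNorm_principal ⟨Units.mk0 q hq0, rfl⟩
  -- `q_𝔸 = (c y)ᵀ (H_𝔸 y)`
  have haval : (a : 𝔸L) = (adeleConj L ∘ y) ⬝ᵥ (HA *ᵥ y) := by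
    change algebraMap L 𝔸L q = _
    rw [hq, algebraMap_hermForm, ← hermForm_mulVec_mulVec hg]
    rfl
  -- finiteness of the height data
  have hyfin : IsHeightFinite L y := by
    rw [hy, ← Mahler.vecMul_transposeGL]
    exact isHeightFinite_principalVec_vecMul hξ _
  have hHyfin : IsHeightFinite L (HA *ᵥ y) := by
    rw [hy, hHA, mulVec_mulVec_principalVec_eq L H hdet g ξ]
    exact isHeightFinite_principalVec_vecMul hξ _
  -- the fundamental inequality: `1 ≤ h(c y) h(H_𝔸 y) ≤ h(y) · B · h(y)`
  have h1 : 1 ≤ vecHeight L y * ((1 ⊔ B) * vecHeight L y) := by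
    have hfi :=
      ideleNorm_le_vecHeight_mul_vecHeight (isHeightFinite_adeleConj L hyfin) hHyfin a haval
    rw [ha1, vecHeight_adeleConj] at hfi
    refine hfi.trans (mul_le_mul_right ?_ _)
    have hHy : HA *ᵥ y = y ᵥ* HAᵀ := (Matrix.vecMul_transpose HA y).symm
    have hfin' : IsHeightFinite L (y ᵥ* HAᵀ) := hHy ▸ hHyfin
    rw [hHy]
    exact (vecHeight_vecMul_le hyfin hfin').trans (mul_le_mul_left le_sup_right _)
  -- conclude `(1 ⊔ B)⁻¹ ≤ h(y)`
  rcases le_or_gt 1 (vecHeight L y) with hge | hlt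
  · exact (inv_le_one_of_one_le₀ (le_sup_left : (1 : ℝ≥0) ≤ 1 ⊔ B)).trans hge
  · refine (NNReal.inv_le hM).mpr ?_
    calc (1 : ℝ≥0) ≤ vecHeight L y * ((1 ⊔ B) * vecHeight L y) := h1
      _ = (1 ⊔ B) * (vecHeight L y * vecHeight L y) := by ring
      _ ≤ (1 ⊔ B) * vecHeight L y :=
          mul_le_mul_right (mul_le_of_le_one_right zero_le hlt.le) _

/-- **`|det g|_𝔸 = 1` on `U(H)(𝔸)`** when `det H ≠ 0`: from `(c g)ᵀ H_𝔸 g = H_𝔸`,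
`c(det g) · det g = 1`, and `|c a|_𝔸 = |a|_𝔸`. [folklore] -/
theorem ideleNorm_det_eq_one (H : Matrix n n L) (hdet : H.det ≠ 0) {g : GL n 𝔸L}
    (hg : g ∈ adelicUnitaryGroup L H) :
    IdeleClassGroup.ideleNorm L (Matrix.GeneralLinearGroup.det g) = 1 := by
  rw [mem_adelicUnitaryGroup_iff] at hg
  set f := algebraMap L 𝔸L with hf
  -- the determinant identity in `𝔸_L`
  have hdetA : adeleConj L (g : Matrix n n 𝔸L).det * (H.map f).det * (g : Matrix n n 𝔸L).det =
      (H.map f).det := by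
    have h := congrArg Matrix.det hg
    rw [Matrix.det_mul, Matrix.det_mul, Matrix.det_transpose] at h
    rw [RingHom.map_det]
    exact h
  have hu : IsUnit (H.map f).det := by
    have h := (isUnit_iff_ne_zero.mpr hdet).map f
    rw [RingHom.map_det] at h
    exact h
  have hone : adeleConj L (g : Matrix n n 𝔸L).det * (g : Matrix n n 𝔸L).det = 1 := by
    refine hu.mul_left_inj.mp ?_
    calc adeleConj L (g : Matrix n n 𝔸L).det * (g : Matrix n n 𝔸L).det * (H.map f).det
        = adeleConj L (g : Matrix n n 𝔸L).det * (H.map f).det * (g : Matrix n n 𝔸L).det := by ring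
      _ = (H.map f).det := hdetA
      _ = 1 * (H.map f).det := (one_mul _).symm
  -- as units, then norms
  set d : (𝔸L)ˣ := Matrix.GeneralLinearGroup.det g with hd
  have hunits : Units.map (adeleConj L : 𝔸L →* 𝔸L) d * d = 1 := by
    apply Units.ext
    rw [Units.val_mul, Units.coe_map, MonoidHom.coe_coe, Units.val_one]
    exact hone
  have hN : IdeleClassGroup.ideleNorm L d * IdeleClassGroup.ideleNorm L d = 1 := by
    have h := congrArg (IdeleClassGroup.ideleNorm L) hunits
    rwa [map_mul, map_one, ideleNorm_unitsMap_adeleConj] at h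
  have hR : ((IdeleClassGroup.ideleNorm L d : ℝ≥0) : ℝ) *
      (IdeleClassGroup.ideleNorm L d : ℝ) = 1 := by
    exact_mod_cast hN
  rcases mul_self_eq_one_iff.mp hR with h | h
  · exact_mod_cast h
  · exfalso
    have := (IdeleClassGroup.ideleNorm L d).coe_nonneg
    linarith

end CMField

end Literature.NumberTheory.Automorphic.Godement
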